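/-
Origin: expansion seat `prover-pub-hodgecm-own-htheta-g2-0`, handover #H27 2026-08-21T13:47:42Z md5 39c7dde641d4 (103 l.; NEW additive MODEL leaf — `_ge` twin(s) D5: Gen12PinsP2.gen12_totalAt_ge; imports Binders.Gen12PinsTotalP2 + #H21; author item6-p2 (prover-pub-hodgecm2-item6-p2-0) under own-htheta; nothing cited, NOT an E term; sha256 62a5178309f2c1f4712be2a0f5befca2b4ef06aa3d2623a343117bd227fca0f7; CERT rc 0 + trio as in the header; NAMES for audit: HodgeCM.Model.Gen12PinsP2.gen12_totalAt_ge ) (`HOME/pub-hodgecm-own-htheta/stage80/HodgeCM/Model/Binders/Gen12PinsTotalP2Ge.lean`, md5 39c7dde641d4, 103 lines);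
landed by the p-seat packager p gen 32 (p-g32) in gate run 79 as `HodgeCM/Model/Binders/Gen12PinsTotalP2Ge.lean` (verbatim).
-/
/-
Copyright (c) 2026 the pub-hodgecm formalisation cell (harness21).  New file, not vendored.
Origin: seat `prover-pub-hodgecm2-item6-p2-0` (unit pub-hodgecm2-item6-p2, TRANSPOSITION item (vi) extra prover p2 queued behind the own-htheta
lineage; coordinator ruling 2026-08-21T13:01:49Z), 2026-08-21 — own-htheta g2 ROUND-2 assignment pub-hodgecm STATUS l.15865 13:09:09Z «(vi-2) D-HEAD
`_ge` TWINS», BATCH 1 (assigned there to item6-p1, who took the tree-side S2 glue instead — pub-hodgecm2/transposition/item-6/p1/STATUS.md 13:29:30Z;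
taken over by p2 so that the D5–D17 twin chain is complete for one cut; hodge-director/ITEM6-SPLIT.md (vi-2)/(vi-4); x2 `D-HEADS-THREADING.md`
8761fc1d3358; x2 `E-HEADS-FACE-BLUEPRINT.md` v1.1 fc085fc795dd §1 rows `gen12`/`real34`).  Target in PKG: `HodgeCM/Model/Binders/Gen12PinsTotalP2Ge.lean` (NEW additive
leaf beside `HodgeCM/Model/Binders/Gen12PinsTotalP2.lean`, installed md5 68ccf478ebd3; imports `HodgeCM.Model.Binders.Gen12PinsTotalP2` + `HodgeCM.Model.ThetaSpaceInputPinGe`; nothing of record imports it).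
KERNEL ONLY: theorems, no proof holes, nothing cited, no hypothesis kind of E, no `def`; nothing here is a claim of the manuscripts under adjudication;
HC_CM is NOT proved.

WHAT IT IS — the `_ge` twin(s) of D5 `gen12_totalAt` (`Binders/Gen12PinsTotalP2.lean`:325):
statements VERBATIM with the sextic guard `(hK : Module.finrank ℚ c.K = 6)` replaced by `(hK : 6 ≤ Module.finrank ℚ c.K)` (what a rank-four face of a
Galois CM field `F` of degree ≥ 6 supplies at `c.K := F`), proofs = the originals' with the TWO regime calls `isAnisotropic_of_goodCtx V hc hK` (:329/:330) replaced by x1's `isAnisotropic_of_goodCtx_ge V hc hK` (#H21 `Model/ThetaSpaceInputPinGe.lean`:65).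
E's sextic heads are the instances `hK := h6.ge` (`Model.six_le_of_finrank_eq_six`, `ThetaSpaceInputPinGe.lean`:76).
Generated from the installed original by `work/gen_twins_b1.py` (token edits listed in `work/gen_twins_b1.report`); section variables byte-identical.
-/
import Summits.HodgeConjecture.HodgeCM.Model.Binders.Gen12PinsTotalP2_2
import Summits.HodgeConjecture.HodgeCM.Model.ThetaSpaceInputPinGe

/-! PORT of `HodgeCM/Model/Binders/Gen12PinsTotalP2Ge.lean` (HodgeCMPerL run 82) — verbatim mechanical port; provenance in the PORT header line. -/

set_option autoImplicit false

noncomputable section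

open MeasureTheory NumberField MulAction
open scoped Matrix InnerProductSpace

namespace HodgeCM.Model

open HodgeCM HodgeCM.Universe HodgeCM.Adelic
open Literature.NumberTheory.Weil1964
open Literature.NumberTheory.Automorphic (piSchwartzBruhat)
open Literature.NumberTheory.Automorphic.UnitaryGroup (archIsotropy archIsotropyProj archKappa archSectionU21CM)
open Literature.NumberTheory.GelbartRogawski1991.UnitaryDualPair
open Literature.RepresentationTheory.HeisenbergGroup
open Literature.Geometry.ComplexHyperbolic.BallModel (U21 x₀ Jac)
open Literature.AlgebraicGeometry.HodgeTheory
open Literature.NumberTheory.Automorphic.PicardCM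
open Literature.NumberTheory.Transcendental (Arapura2012_Cor_15_4_6)
open HodgeCM.Model.ThetaSpace
open HodgeCM.Model.ArchSideTerm

namespace Gen12PinsP2

variable
  (G : ∀ {L : CMField} {ι₁ : L →+* ℂ} (_V : HermSpace3 L ι₁) (_c : SeesawCtx L), Prop)
  (hG : ∀ {L : CMField} {ι₁ : L →+* ℂ} (V : HermSpace3 L ι₁) (c : SeesawCtx L),
    G V c → (∀ j, 0 < (ι₁ (dW c.D j)).re) ∨ ∀ j, (ι₁ (dW c.D j)).re < 0)
  (hGR : ∀ {L : CMField} {ι₁ : L →+* ℂ} (V : HermSpace3 L ι₁) (c : SeesawCtx L),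
    (cmSplittingDatum (L : Type) finProdFinEquiv (frameD V) (frameD_real V) (frameD_ne V) (dW c.D) (dW_real c.D)
      (dW_ne c.D)).CompatibleSplitting)
  (η : ∀ {L : CMField} {ι₁ : L →+* ℂ} (V : HermSpace3 L ι₁) (c : SeesawCtx L),
    CMAdelic (L : Type) (frameD V) × CMAdelic (L : Type) (dW c.D) →* ℂˣ)
  (hη : ∀ {L : CMField} {ι₁ : L →+* ℂ} (V : HermSpace3 L ι₁) (c : SeesawCtx L),
    ∀ γU ∈ CMRat (L : Type) (frameD V), ∀ γ ∈ CMRat (L : Type) (dW c.D), η V c (γU, γ) = 1)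
  (hηc : ∀ {L : CMField} {ι₁ : L →+* ℂ} (V : HermSpace3 L ι₁) (c : SeesawCtx L), Continuous fun p => ((η V c p : ℂˣ) : ℂ))
  (ν : ∀ {L : CMField} {ι₁ : L →+* ℂ} (V : HermSpace3 L ι₁) (_c : SeesawCtx L), CMAdelic (L : Type) (frameD V) →* ℂˣ)
  (hν : ∀ {L : CMField} {ι₁ : L →+* ℂ} (V : HermSpace3 L ι₁) (c : SeesawCtx L), ∀ γU ∈ CMRat (L : Type) (frameD V), ν V c γU = 1)
  (hνc : ∀ {L : CMField} {ι₁ : L →+* ℂ} (V : HermSpace3 L ι₁) (c : SeesawCtx L), Continuous fun v => ((ν V c v : ℂˣ) : ℂ))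
  (ν' : ∀ {L : CMField} {ι₁ : L →+* ℂ} (V : HermSpace3 L ι₁) (_c : SeesawCtx L), CMAdelic (L : Type) (frameD V) →* ℂˣ)
  (hν' : ∀ {L : CMField} {ι₁ : L →+* ℂ} (V : HermSpace3 L ι₁) (c : SeesawCtx L), ∀ γU ∈ CMRat (L : Type) (frameD V), ν' V c γU = 1)
  (hν'c : ∀ {L : CMField} {ι₁ : L →+* ℂ} (V : HermSpace3 L ι₁) (c : SeesawCtx L), Continuous fun v => ((ν' V c v : ℂˣ) : ℂ))
  (hGR₀ : ∀ {L : CMField} {ι₁ : L →+* ℂ} (V : HermSpace3 L ι₁) (c : SeesawCtx L),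
    (cmSplittingDatum (L : Type) (e₁) (frameD V) (frameD_real V) (frameD_ne V) (lineVec (L : Type) (dW c.D 0))
      (fun _ => dW_real c.D 0) (fun _ => dW_ne c.D 0)).CompatibleSplitting)
  (hGR₁ : ∀ {L : CMField} {ι₁ : L →+* ℂ} (V : HermSpace3 L ι₁) (c : SeesawCtx L),
    (cmSplittingDatum (L : Type) (e₁) (frameD V) (frameD_real V) (frameD_ne V) (lineVec (L : Type) (dW c.D 1))
      (fun _ => dW_real c.D 1) (fun _ => dW_ne c.D 1)).CompatibleSplitting)
  (hGR₂ : ∀ {L : CMField} {ι₁ : L →+* ℂ} (V : HermSpace3 L ι₁) (c : SeesawCtx L),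
    (cmSplittingDatum (L : Type) (e₁) (frameD V) (frameD_real V) (frameD_ne V) (lineVec (L : Type) (dW' c.D 0))
      (fun _ => dW'_real c.D 0) (fun _ => dW'_ne c.D 0)).CompatibleSplitting)
  (hGR₃ : ∀ {L : CMField} {ι₁ : L →+* ℂ} (V : HermSpace3 L ι₁) (c : SeesawCtx L),
    (cmSplittingDatum (L : Type) (e₁) (frameD V) (frameD_real V) (frameD_ne V) (lineVec (L : Type) (dW' c.D 1))
      (fun _ => dW'_real c.D 1) (fun _ => dW'_ne c.D 1)).CompatibleSplitting)
  (AG : ∀ {L : CMField} {ι₁ : L →+* ℂ} (V : HermSpace3 L ι₁) (c : SeesawCtx L), G V c → ∀ k : Fin 4,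
    ArchLineInput V (lineRepT' V c.D (hGR V c) (hGR₀ V c) (hGR₁ V c) (hGR₂ V c) (hGR₃ V c) (η V c) (ν V c) (ν' V c) k))

variable (hHD : exists_isReal_hodgeModel) (hI : hodgePQ_independent_of_hodgeModel)
  (h₁ : BallQuotientUniformised)  (h₃ : CMAbelianVarietyRealised)
  (h : Bool) (hA : Arapura2012_Cor_15_4_6) (μ : ∀ {L : CMField}, SeesawCtx L → Fin 4 → InfinitePlace L → ℤ)

/- the TOTAL pins of record are spelled out below: W := `Gen12Pins.Wg @hGR @η @hη @hηc @Gen12Pins.τSyl @Gen12Pins.TSyl @Gen12Pins.hTSyl`, S := `SInstance.SGPT' @G @hG @hGR @η @hη @hηc @ν @hν @hνc @ν' @hν' @hν'c @hGR₀ @hGR₁ @hGR₂ @hGR₃ @AG`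
   (no local notation: `notation3` over section variables mis-elaborates, kit #7 GOTCHA). -/


/-- `_ge` TWIN of `gen12_totalAt` (guard `6 ≤ [c.K:ℚ]` in place of `= 6`; statement otherwise verbatim, proof = the original's with the `_ge` callee). **Row `gen12` PER CONTEXT under the guard** (no family-level guard hypothesis): at a good sextic context `(V, c)` with `hg : G V c` and the
(N1)₀,₁ weights read at THAT context, E's `Gen12FunBridge V c` is inhabited — `Gen12Junctions.nonempty_gen12FunBridge` of the junctions of
`residual_total hg` and `(SeesawCore.ofGuardedPinT2 hg).toHyp`.  This is the shape a POINTWISE-guarded E child (`S := SROG`, bit `orientBitι L ι₁`)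
consumes on its honest branch; the off-guard branch is sanity-1's. -/
theorem gen12_totalAt_ge {L : CMField} {ι₁ : L →+* ℂ} (V : HermSpace3 L ι₁) (c : SeesawCtx L) (hg : G V c)
    (hc : (pinT hHD hI h₁ h₃ h hA (Gen12Pins.Wg @hGR @η @hη @hηc @Gen12Pins.τSyl @Gen12Pins.TSyl @Gen12Pins.hTSyl) (SInstance.SGPT' @G @hG @hGR @η @hη @hηc @ν @hν @hνc @ν' @hν' @hν'c @hGR₀ @hGR₁ @hGR₂ @hGR₃ @AG) μ).GoodCtx ι₁ c) (hK : 6 ≤ Module.finrank ℚ c.K)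
    (hN1 : ∀ k : Fin 4, k = 0 ∨ k = 1 → (AG V c hg k).w = ⇑(archWeight L (μ c k))) :
    Nonempty ((pinT hHD hI h₁ h₃ h hA (Gen12Pins.Wg @hGR @η @hη @hηc @Gen12Pins.τSyl @Gen12Pins.TSyl @Gen12Pins.hTSyl) (SInstance.SGPT' @G @hG @hGR @η @hη @hηc @ν @hν @hνc @ν' @hν' @hν'c @hGR₀ @hGR₁ @hGR₂ @hGR₃ @AG) μ).Gen12FunBridge V c) :=
  ((residual_total @G @hG @hGR @η @hη @hηc @ν @hν @hνc @ν' @hν' @hν'c @hGR₀ @hGR₁ @hGR₂ @hGR₃ @AG hHD hI h₁ h₃ h hA @μ V c (isAnisotropic_of_goodCtx_ge V hc hK) hg).junctions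
    ((SeesawCore.ofGuardedPinT2 @G @hG @hGR @η @hη @hηc @ν @hν @hνc @ν' @hν' @hν'c @hGR₀ @hGR₁ @hGR₂ @hGR₃ @AG hHD hI h₁ h₃ V c (isAnisotropic_of_goodCtx_ge V hc hK) hg).toHyp
      ((ST_P_w @G @hG @hGR @η @hη @hηc @ν @hν @hνc @ν' @hν' @hν'c @hGR₀ @hGR₁ @hGR₂ @hGR₃ @AG V c hg 0).trans (hN1 0 (Or.inl rfl)))
      ((ST_P_w @G @hG @hGR @η @hη @hηc @ν @hν @hνc @ν' @hν' @hν'c @hGR₀ @hGR₁ @hGR₂ @hGR₃ @AG V c hg 1).trans (hN1 1 (Or.inr rfl)))) hc).nonempty_gen12FunBridge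

end Gen12PinsP2

end HodgeCM.Model

end
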